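import Summits.QuantumFields.GaugeBoot.SU2LoopPairInversion
import Summits.QuantumFields.GaugeBoot.LoopClasses
import Summits.QuantumFields.GaugeBoot.ZdLoopClasses
import HarnessLib

/-!
# An explicit pair of `ℤ²` loop classes with identical `SU(2)` loop variables that no lattice symmetry,
# reversal or rotation relates (gauge-boot, large-`N` supplement 17, part 3)

HONEST FRAMING (cell `pub-gaugeboot`, page 1 of every file): the venture produces certified bounds
on lattice expectations at stated coupling, gauge group, dimension and torus size; NOT a mass gap,
NOT a continuum limit, NOT a string tension; NOT large `N` unless marked CONDITIONAL; NOT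
Yang–Mills-summit-bearing (barriers `FixedCouplingUltralocality`, `PerturbativeInvisibility`).
Lattice combinatorics (`decide`) plus parts 1–2; this file certifies no number.

## Content (`d = 2`)

* `pSq = +e₀+e₁−e₀−e₁` (the unit plaquette) and `qBar = +e₀+e₀−e₁−e₀−e₀+e₁` (the `2 × 1` rectangle in
  the quadrant `(+, −)`), both based at the origin; the free-group word `ell = a²ba⁻¹b⁻¹`;
  `loop₁ = ell(pSq, qBar)`, `loop₂ = ell(pSq⁻¹, qBar⁻¹)` (length `24`), and their cyclically reduced
  forms `c₁`, `c₂` (length `22`; `Word.canon [] false 1 0 loopᵢ = cᵢ` by `decide`).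
* ★★ `wordLoop_loop₂_eq_loop₁` / `wordLoopZd_loop₂_eq_loop₁` — over `SU(2)` the loop variables of
  `loop₁` and `loop₂` are EQUAL AS FUNCTIONS (part 2), on every torus and on `ℤ²`;
  ★★ `wilsonExpectation_c₁_eq_c₂` — `⟨W_0(c₁)⟩_{β,L} = ⟨W_0(c₂)⟩_{β,L}` for `SU(2)` on every torus
  `(ℤ/L)²`, every `β` (the lane's `wilsonExpectation_wordLoop_canon` moves `loopᵢ` to `cᵢ`).
* ★★ `canon_c₁_ne_c₂` — **`c₂` is NOT in the lattice-symmetry class of `c₁`**: for EVERY list of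
  hyperoctahedral moves `ms`, every reversal flag and all rotation amounts,
  `Word.canon ms rev k₁ k₂ c₁ ≠ c₂` (and symmetrically).  Proof: the moves of `B₂` act on steps through
  eight signed permutations (`b2Act`, closure by `decide`), so every canonical image of the cyclically
  reduced `c₁` lies in an explicit list of `8 · 2 · 22 = 352` words (`classList`), none of which is `c₂`
  (`decide`).

So `y[c₁] = y[c₂]` is an exact identity between two DISTINCT variables of any `SU(2)` loop list
indexed by symmetry classes (KZ2022 / the cell's `LoopClasses` canon), valid in every state at every
coupling — the first members (length `22`) of the infinite family of part 2.  Not claimed: that `22`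
is the minimal length of such a pair on `ℤ²` (not searched exhaustively); anything for `N ≥ 3`
(part 1 `trace_three_ne`; numerically the `SU(3)` loop variables of `c₁`, `c₂` differ).  [folklore]
-/

noncomputable section

open MeasureTheory
open Literature.MathematicalPhysics.QuantumFieldTheory
open Literature.MathematicalPhysics.QuantumLattice (LGConfig)

namespace Summit.QuantumFields.GaugeBoot

namespace PairInversionExample

/-! ## The two generating loops, the word `a²ba⁻¹b⁻¹`, and the two lattice loops -/

/-- The unit plaquette `+e₀ +e₁ −e₀ −e₁` at the origin of `ℤ²`. [folklore] -/
def pSq : Word 2 := [.fwd 0, .fwd 1, .bwd 0, .bwd 1]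

/-- The `2 × 1` rectangle `+e₀ +e₀ −e₁ −e₀ −e₀ +e₁` in the quadrant `(+, −)` at the origin. [folklore] -/
def qBar : Word 2 := [.fwd 0, .fwd 0, .bwd 1, .bwd 0, .bwd 0, .fwd 1]

/-- The pair of generating loops `(pSq, qBar)`. [folklore] -/
def gens : Fin 2 → Word 2 := ![pSq, qBar]

/-- The free-group word `a² b a⁻¹ b⁻¹` (Mathlib letter convention). [folklore] -/
def ell : List (Fin 2 × Bool) := [(0, true), (0, true), (1, true), (0, false), (1, false)]

/-- `loop₁ = pSq · pSq · qBar · pSq⁻¹ · qBar⁻¹` (length `24`). [folklore] -/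
def loop₁ : Word 2 := Word.subst gens ell

/-- `loop₂ = pSq⁻¹ · pSq⁻¹ · qBar⁻¹ · pSq · qBar` (length `24`): both generators inverted, order kept. [folklore] -/
def loop₂ : Word 2 := Word.subst gens (invLetters ell)

/-- `loop₁` written out. [folklore] -/
theorem loop₁_eq : loop₁ = [.fwd 0, .fwd 1, .bwd 0, .bwd 1, .fwd 0, .fwd 1, .bwd 0, .bwd 1, .fwd 0, .fwd 0, .bwd 1, .bwd 0,
    .bwd 0, .fwd 1, .fwd 1, .fwd 0, .bwd 1, .bwd 0, .bwd 1, .fwd 0, .fwd 0, .fwd 1, .bwd 0, .bwd 0] := by decide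

/-- `loop₂` written out. [folklore] -/
theorem loop₂_eq : loop₂ = [.fwd 1, .fwd 0, .bwd 1, .bwd 0, .fwd 1, .fwd 0, .bwd 1, .bwd 0, .bwd 1, .fwd 0, .fwd 0, .fwd 1,
    .bwd 0, .bwd 0, .fwd 0, .fwd 1, .bwd 0, .bwd 1, .fwd 0, .fwd 0, .bwd 1, .bwd 0, .bwd 0, .fwd 1] := by decide

/-- The cyclically reduced form of `loop₁` (length `22`). [folklore] -/
def c₁ : Word 2 := [.fwd 1, .bwd 0, .bwd 1, .fwd 0, .fwd 1, .bwd 0, .bwd 1, .fwd 0, .fwd 0, .bwd 1, .bwd 0, .bwd 0,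
  .fwd 1, .fwd 1, .fwd 0, .bwd 1, .bwd 0, .bwd 1, .fwd 0, .fwd 0, .fwd 1, .bwd 0]

/-- The cyclically reduced form of `loop₂` (length `22`). [folklore] -/
def c₂ : Word 2 := [.fwd 0, .bwd 1, .bwd 0, .fwd 1, .fwd 0, .bwd 1, .bwd 0, .bwd 1, .fwd 0, .fwd 0, .fwd 1, .bwd 0,
  .fwd 1, .bwd 0, .bwd 1, .fwd 0, .fwd 0, .bwd 1, .bwd 0, .bwd 0, .fwd 1, .fwd 1]

/-- `c₁` is the lane's canonical image of `loop₁` under (no move, no reversal, rotate `1`, free reduction). [folklore] -/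
theorem canon_loop₁ : Word.canon [] false 1 0 loop₁ = c₁ := by decide

/-- `c₂` is the lane's canonical image of `loop₂` under the same pipeline. [folklore] -/
theorem canon_loop₂ : Word.canon [] false 1 0 loop₂ = c₂ := by decide

/-- `c₁ ≠ c₂`; both have length `22`. [folklore] -/
theorem c₁_ne_c₂ : c₁ ≠ c₂ ∧ c₁.length = 22 ∧ c₂.length = 22 := by decide

/-! ## Closedness -/

/-- Both generating loops have zero displacement. [folklore] -/
theorem disp_gens (i : Fin 2) : Word.disp (gens i) = 0 := by fin_cases i <;> decide

/-- Both generating loops are closed at every site of every torus. [folklore] -/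
theorem endpoint_gens {L : ℕ} (x : Site 2 L) (i : Fin 2) : Word.endpoint x (gens i) = x :=
  Word.endpoint_eq_self_of_disp x (disp_gens i)

/-- Both generating loops are closed at every site of `ℤ²`. [folklore] -/
theorem endpointZd_gens (x : Fin 2 → ℤ) (i : Fin 2) : Word.endpointZd x (gens i) = x :=
  endpointZd_eq_self_of_disp x (disp_gens i)

/-! ## Identical `SU(2)` loop variables -/

/-- ★★ **Over `SU(2)`, `loop₁` and `loop₂` have the same loop variable at every site of every torus, as
functions of the configuration** (part 2). [folklore] -/
theorem wordLoop_loop₂_eq_loop₁ {L : ℕ} (x : Site 2 L) : wordLoop (suRep 2) x loop₂ = wordLoop (suRep 2) x loop₁ :=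
  wordLoop_subst_invLetters x gens (endpoint_gens x) ell

/-- ★★ The same on `ℤ²`. [folklore] -/
theorem wordLoopZd_loop₂_eq_loop₁ (x : Fin 2 → ℤ) : wordLoopZd (suRep 2) x loop₂ = wordLoopZd (suRep 2) x loop₁ :=
  wordLoopZd_subst_invLetters x gens (endpointZd_gens x) ell

/-- ★★ **`⟨W_0(c₁)⟩_{β,L} = ⟨W_0(c₂)⟩_{β,L}` for `SU(2)` on every torus `(ℤ/L)²` at every coupling** —
an exact identity between the expectations of two loops of length `22` in different symmetry classes
(`canon_c₁_ne_c₂`). [folklore] -/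
theorem wilsonExpectation_c₁_eq_c₂ {L : ℕ} [NeZero L] (β : ℝ) :
    wilsonExpectation (suRep 2) β (wordLoop (suRep 2) (0 : Site 2 L) c₁) =
      wilsonExpectation (suRep 2) β (wordLoop (suRep 2) (0 : Site 2 L) c₂) := by
  have h1 := wilsonExpectation_wordLoop_canon (L := L) (suRep 2) (continuous_suRep 2) β [] false 1 0 loop₁ (by decide)
  have h2 := wilsonExpectation_wordLoop_canon (L := L) (suRep 2) (continuous_suRep 2) β [] false 1 0 loop₂ (by decide)
  rw [canon_loop₁] at h1
  rw [canon_loop₂] at h2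
  rw [← h1, ← h2, wordLoop_loop₂_eq_loop₁]

/-! ## `c₂` is not in the lattice-symmetry class of `c₁` -/

/-- The eight signed permutations of the steps of `ℤ²`, coded by (swap the axes?, flip axis `0`?,
flip axis `1`?). [folklore] -/
def b2Act (c : Bool × Bool × Bool) (s : Step 2) : Step 2 :=
  let s₁ := bif c.1 then s.permute (Equiv.swap 0 1) else s
  let s₂ := bif c.2.1 then s₁.reflectAxis 0 else s₁
  bif c.2.2 then s₂.reflectAxis 1 else s₂

/-- The four steps of `ℤ²`. [folklore] -/
def allSteps : List (Step 2) := [.fwd 0, .fwd 1, .bwd 0, .bwd 1]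

/-- Every step of `ℤ²` is one of the four. [folklore] -/
theorem mem_allSteps (s : Step 2) : s ∈ allSteps := by
  cases s with
  | fwd μ => fin_cases μ <;> simp [allSteps]
  | bwd μ => fin_cases μ <;> simp [allSteps]

/-- The eight codes. [folklore] -/
def allCodes : List (Bool × Bool × Bool) :=
  [(false, false, false), (false, false, true), (false, true, false), (false, true, true),
   (true, false, false), (true, false, true), (true, true, false), (true, true, true)]

/-- Every code is one of the eight. [folklore] -/
theorem mem_allCodes (c : Bool × Bool × Bool) : c ∈ allCodes := by revert c; decide

/-- Closure, swap: composing a signed permutation with the axis swap is a signed permutation. [folklore] -/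
theorem closure_swap : ∀ c : Bool × Bool × Bool, ∃ c' : Bool × Bool × Bool, ∀ s ∈ allSteps,
    (b2Act c s).permute (Equiv.swap 0 1) = b2Act c' s := by decide

/-- Closure, `reflect0`. [folklore] -/
theorem closure_reflect0 : ∀ c : Bool × Bool × Bool, ∃ c' : Bool × Bool × Bool, ∀ s ∈ allSteps,
    (b2Act c s).reflect0 = b2Act c' s := by decide

/-- Closure, `reflectAxis k`. [folklore] -/
theorem closure_reflectAxis : ∀ k : Fin 2, ∀ c : Bool × Bool × Bool, ∃ c' : Bool × Bool × Bool, ∀ s ∈ allSteps,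
    (b2Act c s).reflectAxis k = b2Act c' s := by decide

/-- Every move of `B₂` composed with a signed permutation is a signed permutation. [folklore] -/
theorem closure_act (m : Move 2) (c : Bool × Bool × Bool) : ∃ c' : Bool × Bool × Bool, ∀ s, m.act (b2Act c s) = b2Act c' s := by
  cases m with
  | perm π =>
    -- `Perm (Fin 2) = {1, (0 1)}` (the tree's `Literature.Barriers.ValiantsHypothesis.perm_fin_two_eq`, inlined
    -- to keep the import closure inside the cell)
    have hπ : π = 1 ∨ π = Equiv.swap 0 1 := by revert π; decide
    rcases hπ with rfl | rfl
    · exact ⟨c, fun s => by cases h : b2Act c s <;> rfl⟩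
    · obtain ⟨c', hc'⟩ := closure_swap c
      exact ⟨c', fun s => hc' s (mem_allSteps s)⟩
  | refl0 =>
    obtain ⟨c', hc'⟩ := closure_reflect0 c
    exact ⟨c', fun s => hc' s (mem_allSteps s)⟩
  | refl k =>
    obtain ⟨c', hc'⟩ := closure_reflectAxis k c
    exact ⟨c', fun s => hc' s (mem_allSteps s)⟩

/-- **Every list of moves acts on words through one of the eight signed permutations.** [folklore] -/
theorem exists_acts_eq_map (ms : List (Move 2)) : ∃ c : Bool × Bool × Bool, ∀ w : Word 2, Word.acts ms w = w.map (b2Act c) := by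
  induction ms with
  | nil =>
    refine ⟨(false, false, false), fun w => ?_⟩
    rw [Word.acts_nil]
    conv_lhs => rw [← List.map_id w]
    rfl
  | cons m ms ih =>
    obtain ⟨c, hc⟩ := ih
    obtain ⟨c', hc'⟩ := closure_act m c
    refine ⟨c', fun w => ?_⟩
    rw [Word.acts_cons, hc, List.map_map]
    exact List.map_congr_left fun s _ => hc' s

/-- Parameters of the enumeration: code, reversal flag, rotation amount `< 22`. [folklore] -/
def params : List ((Bool × Bool × Bool) × Bool × ℕ) := allCodes ×ˢ ([false, true] ×ˢ List.range 22)

/-- The image of a word under (signed permutation, optional reversal, rotation). [folklore] -/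
def img (w : Word 2) (π : (Bool × Bool × Bool) × Bool × ℕ) : Word 2 :=
  (bif π.2.1 then Word.reverse (w.map (b2Act π.1)) else w.map (b2Act π.1)).rotate π.2.2

/-- The `352` candidate images of a word of length `22`. [folklore] -/
def classList (w : Word 2) : List (Word 2) := params.map (img w)

/-- Membership in the enumeration. [folklore] -/
theorem img_mem_classList (w : Word 2) (c : Bool × Bool × Bool) (r : Bool) {k : ℕ} (hk : k < 22) :
    img w (c, r, k) ∈ classList w := by
  refine List.mem_map.2 ⟨(c, r, k), ?_, rfl⟩
  simp only [params, List.mem_product, List.mem_range]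
  exact ⟨mem_allCodes c, by cases r <;> simp, hk⟩

/-- Every candidate image of `c₁` is freely reduced (so the canon's free reduction does nothing). [folklore] -/
theorem freeReduce_of_mem_classList_c₁ : ∀ v ∈ classList c₁, Word.freeReduce v = v := by decide +kernel

/-- **`c₂` is none of the `352` candidate images of `c₁`.** [folklore] -/
theorem c₂_not_mem_classList_c₁ : c₂ ∉ classList c₁ := by decide

/-- Every candidate image of `c₂` is freely reduced. [folklore] -/
theorem freeReduce_of_mem_classList_c₂ : ∀ v ∈ classList c₂, Word.freeReduce v = v := by decide +kernel

/-- `c₁` is none of the `352` candidate images of `c₂`. [folklore] -/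
theorem c₁_not_mem_classList_c₂ : c₁ ∉ classList c₂ := by decide

/-- The lane's canonical image of a length-`22` word all of whose candidate images are reduced lies in
the candidate list. [folklore] -/
theorem canon_mem_classList {w : Word 2} (hw : w.length = 22) (hred : ∀ v ∈ classList w, Word.freeReduce v = v)
    (ms : List (Move 2)) (rev : Bool) (k₁ k₂ : ℕ) : Word.canon ms rev k₁ k₂ w ∈ classList w := by
  obtain ⟨c, hc⟩ := exists_acts_eq_map ms
  unfold Word.canon
  rw [hc]
  set u : Word 2 := if rev then Word.reverse (w.map (b2Act c)) else w.map (b2Act c) with hu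
  have hu' : ∀ k, u.rotate k = img w (c, rev, k) := fun k => by
    cases rev <;> simp [u, img]
  have hlen : u.length = 22 := by
    cases rev <;> simp [u, Word.reverse, hw]
  have hrot : ∀ k, u.rotate k = u.rotate (k % 22) := fun k => by rw [← hlen, List.rotate_mod]
  have hred' : ∀ k, Word.freeReduce (u.rotate k) = u.rotate k := fun k => by
    rw [hrot, hu']
    exact hred _ (img_mem_classList w c rev (Nat.mod_lt _ (by norm_num)))
  rw [hred', List.rotate_rotate, hrot, hu']
  exact img_mem_classList w c rev (Nat.mod_lt _ (by norm_num))

/-- ★★ **`c₂` is not in the lattice-symmetry class of `c₁`**: no hyperoctahedral moves, reversal and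
rotations (the lane's `Word.canon` pipeline, free reduction included) take `c₁` to `c₂`. [folklore] -/
theorem canon_c₁_ne_c₂ (ms : List (Move 2)) (rev : Bool) (k₁ k₂ : ℕ) : Word.canon ms rev k₁ k₂ c₁ ≠ c₂ := fun h =>
  c₂_not_mem_classList_c₁ (h ▸ canon_mem_classList (by decide) freeReduce_of_mem_classList_c₁ ms rev k₁ k₂)

/-- ★★ Symmetrically, no canonical image of `c₂` is `c₁`. [folklore] -/
theorem canon_c₂_ne_c₁ (ms : List (Move 2)) (rev : Bool) (k₁ k₂ : ℕ) : Word.canon ms rev k₁ k₂ c₂ ≠ c₁ := fun h =>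
  c₁_not_mem_classList_c₂ (h ▸ canon_mem_classList (by decide) freeReduce_of_mem_classList_c₂ ms rev k₁ k₂)

end PairInversionExample

end Summit.QuantumFields.GaugeBoot

end
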